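import Summits.BirchSwinnertonDyer.BirchSwinnertonDyer.Theorems.PrintCFramBottomClassIndexLawFiveLeSelmerDevissageLocalCriterionIsogeny
import Summits.BirchSwinnertonDyer.BirchSwinnertonDyer.Theorems.PrintCFramBottomClassIndexLawFiveLeSelmerCountCaseSLocal
import HarnessLib

/-!
# Route `PrintCFram`, crux C2 `BottomClassIndexLawFiveLe` (stmt-BirchSwinnertonDyer-20372), line
# `eisenstein-resource-bdp-line` (registry v19/v20): **THE RANK-ONE SEE-SAW ON THE CLASS** — no rational `p`-torsion (so torsion is
# `p`-divisible), and «the generator has no `ker φ`-adapted `p`-th root at ONE place ⟹ the PARTNER's generator is `φ(g)` modulo torsion»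
# (cell `bsd-print-cfram`, width seat `bsd-line-cfram-p1-w6` g4; helper `--supports` 20372; 0 defs, 0 facts, 0 sorry)

HONEST FRAMING. Nothing about BSD is proved here and no stub is closed. Sequel of `…SelmerDevissageLocalCriterionIsogeny` (§1 there: a rational
point in `ψ(W'(ℚ)) + pW(ℚ)` has `Φ`-adapted roots everywhere, `Φ = ker φ|_{W[p]}`, `ψ ∘ φ = [p]`; §3–§4: the see-saw of a dual pair on two
rank-one groups, and its reading on a transverse member with a LEVEL-`0` generator, under the hypothesis that the rational torsion is
`p`-divisible). Here:

* §1 `exists_eq_nsmul_of_isOfFinAddOrder` — in an abelian group without `p`-torsion every torsion element is `p • T₁` (its order is prime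
  to `p`; Mathlib `exists_nsmul_eq_self_of_coprime`); **`forall_nsmul_eq_zero_imp_of_natCard_ker_eq_one`** — `W(ℚ_v)[p] = 0 ⟹ W(ℚ)[p] = 0`
  (`W(ℚ) ↪ W(ℚ_v)`); so on the CM-ramified class (`natCard_ker_nsmul_adicCompletion_eq_one_of_cmRamified`) the rational torsion is
  `p`-divisible: **`exists_eq_nsmul_of_isOfFinAddOrder_of_cmRamified`**.
* §2 **`exists_partner_generator_eq_pointHom_add_torsion_of_not_adaptedRoot`** — SHARPER than `…Isogeny` §4: for a dual pair `φ : W → W'`,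
  `ψ : W' → W` (`ψ ∘ φ = [p]`) with maps `f`, `f'` on rational points (`f' (f P) = p • P`, `ι (f' Q') = ψ (ι Q')`), generators `g`, `g'` modulo
  torsion of infinite order, NO rational `p`-torsion on `W`: if `g` has NO `ker φ`-adapted `p`-th root at SOME finite place `v`, then
  `g' = f Q + T'` with `T'` torsion (no (LT), no LEVEL hypothesis: `g = f' Q' + T` would give an adapted root everywhere by `…Isogeny` §1);
  **`…_of_cmRamified`** with the torsion input discharged. With `…LocalCriterionPoint`: «no adapted root of the LEVEL-`0` generator at `p`»
  is exactly (LT) there, so this is the class form of «on the Kriz–Li locus the transverse model's partner generator is `φ(g)`».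

THEOREMS ONLY; no definition, no named fact, no `sorry`. BSD is not proved by any of this; no summit statement is proved by this seat. References:
[SilvermanAEC2009] III.6.1–6.2, VII.§3 (Prop. 3.1), X.§4 (Rem. 4.7, Ex. 4.8); seat notes w6g4.
-/

set_option autoImplicit false
-- `…BirchSwinnertonDyer.BirchSwinnertonDyer.Theorems…` is the problem's mandated namespace (D-0017).
set_option linter.dupNamespace false

noncomputable section

open scoped Classical

namespace Summit.BirchSwinnertonDyer.BirchSwinnertonDyer.Theorems.PrintCFram.SelmerCount

open NumberField IsDedekindDomain Field WeierstrassCurve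
open Literature.NumberTheory.EllipticCurves Literature.NumberTheory.GaloisRepresentations
  Literature.NumberTheory.EllipticCurves.GreenbergSelmer Literature.NumberTheory.EllipticCurves.Rank1Residual
open Summit.BirchSwinnertonDyer.Rank1Residual.X2.ResidualDevissageModules

variable {p : ℕ} [hp : Fact p.Prime]

/-! ## §1 No `p`-torsion: torsion is `p`-divisible; the class input -/

section Torsion

/-- In an abelian group with no `p`-torsion every torsion element is `p`-divisible: `T = p • T₁` (its order is prime to `p`, Mathlib
`exists_nsmul_eq_self_of_coprime`). [folklore] -/
theorem exists_eq_nsmul_of_isOfFinAddOrder {A : Type} [AddCommGroup A] (hnp : ∀ T : A, p • T = 0 → T = 0) {T : A}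
    (hT : IsOfFinAddOrder T) : ∃ T₁ : A, T = p • T₁ := by
  have hcop : Nat.Coprime p (addOrderOf T) := by
    rw [Nat.Prime.coprime_iff_not_dvd hp.out]
    rintro ⟨k, hk⟩
    have hn : 0 < addOrderOf T := hT.addOrderOf_pos
    have hk0 : 0 < k := Nat.pos_of_ne_zero (by rintro rfl; rw [mul_zero] at hk; omega)
    have hkT : k • T = 0 := hnp (k • T) (by rw [← mul_nsmul, mul_comm, ← hk]; exact addOrderOf_nsmul_eq_zero T)
    have hdvd := addOrderOf_dvd_of_nsmul_eq_zero hkT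
    rw [hk] at hdvd
    have hle := Nat.le_of_dvd hk0 hdvd
    have h2 : 2 * k ≤ p * k := Nat.mul_le_mul_right k hp.out.two_le
    omega
  obtain ⟨m, hm⟩ := exists_nsmul_eq_self_of_coprime hcop
  exact ⟨m • T, by rw [smul_comm, hm]⟩

variable (W : WeierstrassCurve ℚ) [W.IsElliptic]

omit [W.IsElliptic] hp in
/-- **`W(ℚ_v)[p] = 0 ⟹ W(ℚ)[p] = 0`** (`W(ℚ) ↪ W(ℚ_v)` along `ℚ → ℚ_v`, Silverman VII.3.1's proof). [cite: SilvermanAEC2009, VII.§3 (proof of Prop. 3.1)] -/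
theorem forall_nsmul_eq_zero_imp_of_natCard_ker_eq_one (v : HeightOneSpectrum (𝓞 ℚ))
    (htors : Nat.card (nsmulAddMonoidHom p :
      (W.baseChange (v.adicCompletion ℚ)).toAffine.Point →+ _).ker = 1) :
    ∀ T : W.toAffine.Point, p • T = 0 → T = 0 := by
  intro T hT
  set ι : W.toAffine.Point →+ (W.baseChange (v.adicCompletion ℚ)).toAffine.Point :=
    Affine.Point.map (W' := W.toAffine) (S := ℚ) (Algebra.ofId ℚ (v.adicCompletion ℚ)) with hι
  have h1 : ι T ∈ (nsmulAddMonoidHom p : (W.baseChange (v.adicCompletion ℚ)).toAffine.Point →+ _).ker := by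
    rw [AddMonoidHom.mem_ker, nsmulAddMonoidHom_apply, ← map_nsmul, hT, map_zero]
  haveI : Subsingleton (nsmulAddMonoidHom p : (W.baseChange (v.adicCompletion ℚ)).toAffine.Point →+ _).ker :=
    (Nat.card_eq_one_iff_unique.mp htors).1
  have h2 : ι T = 0 :=
    congrArg Subtype.val (Subsingleton.elim (⟨ι T, h1⟩ : (nsmulAddMonoidHom p : _ →+ _).ker) ⟨0, zero_mem _⟩)
  exact Affine.Point.map_injective (W' := W.toAffine) (Algebra.ofId ℚ (v.adicCompletion ℚ)) (h2.trans (map_zero ι).symm)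

/-- **On the CM-ramified class the rational torsion is `p`-divisible** (`W` globally minimal, CM, `p ≥ 5` CM-ramified): no `p`-torsion in
`W(ℚ_v)` (`natCard_ker_nsmul_adicCompletion_eq_one_of_cmRamified`), hence none in `W(ℚ)`, hence every torsion `T` is `p • T₁`.
[cite: SilvermanAEC2009, VII.§3 (proof of Prop. 3.1)] -/
theorem exists_eq_nsmul_of_isOfFinAddOrder_of_cmRamified [W.IsGloballyMinimal] (hCM : W.HasCM) (h5 : 5 ≤ p) (hram : CMRamified W p)
    {v : HeightOneSpectrum (𝓞 ℚ)} (hpv : ((p : ℕ) : 𝓞 ℚ) ∈ v.asIdeal)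
    {T : W.toAffine.Point} (hT : IsOfFinAddOrder T) : ∃ T₁ : W.toAffine.Point, T = p • T₁ :=
  exists_eq_nsmul_of_isOfFinAddOrder
    (forall_nsmul_eq_zero_imp_of_natCard_ker_eq_one W v
      (natCard_ker_nsmul_adicCompletion_eq_one_of_cmRamified W hCM h5 hram hpv)) hT

end Torsion

/-! ## §2 The see-saw decided by one missing adapted root -/

section SeeSawClass

variable {W W' : WeierstrassCurve ℚ} [W.IsElliptic] [W'.IsElliptic]

/-- **No `ker φ`-adapted root of the generator at ONE place ⟹ the partner's generator is `φ(g)` modulo torsion.** `φ : W → W'`, `ψ : W' → W`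
`ℚ`-isogenies with `ψ (φ R) = p • R`; `f`, `f'` their maps on rational points (`f' (f P) = p • P`, `ι (f' Q') = ψ (ι Q')`); `Φ = ker φ|_{W[p]}`;
`g`, `g'` generators modulo torsion of `W(ℚ)`, `W'(ℚ)` of infinite order; `W(ℚ)` without `p`-torsion. If at some finite place `v` the point `g`
has NO `Φ`-adapted `p`-th root, then `g' = f Q + T'` (`T'` torsion): otherwise the see-saw (`seeSaw_of_dual_pair`) gives `g = f' Q' + T = f' Q' + p T₁`,
and such a point has adapted roots everywhere (`exists_adaptedRoot_of_eq_dual_apply`). [cite: SilvermanAEC2009, III.6.2 and X.§4 (Rem. 4.7, Ex. 4.8)] -/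
theorem exists_partner_generator_eq_pointHom_add_torsion_of_not_adaptedRoot (φ : Isogeny W W') (ψ : Isogeny W' W)
    (hdual : ∀ R : geomPoints W, ψ (φ R) = (p : ℤ) • R)
    (f : W.toAffine.Point →+ W'.toAffine.Point) (f' : W'.toAffine.Point →+ W.toAffine.Point)
    (hff' : ∀ P, f' (f P) = p • P) (hf' : ∀ Q', toGeomPoints W (f' Q') = ψ (toGeomPoints W' Q'))
    (Φ : StableSubgroup (absoluteGaloisGroup ℚ) (geomTorsion W (p : ℤ)))
    (hker : ∀ t : geomTorsion W (p : ℤ), t ∈ Φ.toAddSubgroup ↔ φ (t : geomPoints W) = 0)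
    (hnp : ∀ T : W.toAffine.Point, p • T = 0 → T = 0)
    {g : W.toAffine.Point} (hg : ¬ IsOfFinAddOrder g)
    (hgen : ∀ R : W.toAffine.Point, ∃ (k : ℤ) (T : W.toAffine.Point), IsOfFinAddOrder T ∧ R = k • g + T)
    {g' : W'.toAffine.Point} (hg' : ¬ IsOfFinAddOrder g')
    (hgen' : ∀ R : W'.toAffine.Point, ∃ (k : ℤ) (T : W'.toAffine.Point), IsOfFinAddOrder T ∧ R = k • g' + T)
    (v : HeightOneSpectrum (𝓞 ℚ))
    (hng : ¬ ∃ R : localPoints W (v.adicCompletion ℚ),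
        (p : ℤ) • R = pointsMap W (v.adicCompletion ℚ) (toGeomPoints W g) ∧
        ∀ σ : absoluteGaloisGroup (v.adicCompletion ℚ), ∃ t ∈ Φ.toAddSubgroup,
          σ • R - R = pointsMap W (v.adicCompletion ℚ) (t : geomPoints W)) :
    ∃ (Q : W.toAffine.Point) (T' : W'.toAffine.Point), IsOfFinAddOrder T' ∧ g' = f Q + T' := by
  refine ((seeSaw_of_dual_pair f f' hff' hg hgen hg' hgen').1).resolve_left ?_
  rintro ⟨Q', T, hT, hgQ⟩
  obtain ⟨T₁, rfl⟩ := exists_eq_nsmul_of_isOfFinAddOrder hnp hT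
  refine hng (exists_adaptedRoot_of_eq_dual_apply φ ψ hdual Φ hker g T₁ Q' ?_ v)
  rw [hgQ, toGeomPoints_add_rat, hf', toGeomPoints_nsmul_rat, natCast_zsmul]

/-- **The same on the CM-ramified class, torsion input discharged** (`W` globally minimal, CM, `p ≥ 5` CM-ramified, `v₀ ∣ p` the place carrying `W(ℚ_{v₀})[p] = 0`: `W(ℚ)` has no `p`-torsion; `v` any finite place).
With `…LocalCriterionPoint.forall_imp_iff_of_level_zero`: at `v ∣ p`, «no adapted root of the LEVEL-`0` generator» is (LT), so this is the class form
of «on the Kriz–Li locus the transverse model's partner generator is `φ(g)` up to torsion» — `p ∤ [W'(ℚ) : φW(ℚ) + tors]`, `p ∣ [W(ℚ) : ψW'(ℚ) + tors]`.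
[cite: SilvermanAEC2009, III.6.2 and X.§4 (Rem. 4.7, Ex. 4.8)] -/
theorem exists_partner_generator_eq_pointHom_add_torsion_of_not_adaptedRoot_of_cmRamified [W.IsGloballyMinimal]
    (hCM : W.HasCM) (h5 : 5 ≤ p) (hram : CMRamified W p) (φ : Isogeny W W') (ψ : Isogeny W' W)
    (hdual : ∀ R : geomPoints W, ψ (φ R) = (p : ℤ) • R)
    (f : W.toAffine.Point →+ W'.toAffine.Point) (f' : W'.toAffine.Point →+ W.toAffine.Point)
    (hff' : ∀ P, f' (f P) = p • P) (hf' : ∀ Q', toGeomPoints W (f' Q') = ψ (toGeomPoints W' Q'))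
    (Φ : StableSubgroup (absoluteGaloisGroup ℚ) (geomTorsion W (p : ℤ)))
    (hker : ∀ t : geomTorsion W (p : ℤ), t ∈ Φ.toAddSubgroup ↔ φ (t : geomPoints W) = 0)
    {g : W.toAffine.Point} (hg : ¬ IsOfFinAddOrder g)
    (hgen : ∀ R : W.toAffine.Point, ∃ (k : ℤ) (T : W.toAffine.Point), IsOfFinAddOrder T ∧ R = k • g + T)
    {g' : W'.toAffine.Point} (hg' : ¬ IsOfFinAddOrder g')
    (hgen' : ∀ R : W'.toAffine.Point, ∃ (k : ℤ) (T : W'.toAffine.Point), IsOfFinAddOrder T ∧ R = k • g' + T)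
    {v₀ : HeightOneSpectrum (𝓞 ℚ)} (hpv₀ : ((p : ℕ) : 𝓞 ℚ) ∈ v₀.asIdeal) (v : HeightOneSpectrum (𝓞 ℚ))
    (hng : ¬ ∃ R : localPoints W (v.adicCompletion ℚ),
        (p : ℤ) • R = pointsMap W (v.adicCompletion ℚ) (toGeomPoints W g) ∧
        ∀ σ : absoluteGaloisGroup (v.adicCompletion ℚ), ∃ t ∈ Φ.toAddSubgroup,
          σ • R - R = pointsMap W (v.adicCompletion ℚ) (t : geomPoints W)) :
    ∃ (Q : W.toAffine.Point) (T' : W'.toAffine.Point), IsOfFinAddOrder T' ∧ g' = f Q + T' :=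
  exists_partner_generator_eq_pointHom_add_torsion_of_not_adaptedRoot φ ψ hdual f f' hff' hf' Φ hker
    (forall_nsmul_eq_zero_imp_of_natCard_ker_eq_one W v₀
      (natCard_ker_nsmul_adicCompletion_eq_one_of_cmRamified W hCM h5 hram hpv₀)) hg hgen hg' hgen' v hng

end SeeSawClass

end Summit.BirchSwinnertonDyer.BirchSwinnertonDyer.Theorems.PrintCFram.SelmerCount

end
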